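import Literature.Computability.Cryptography.HallgrenRealClassOrder
import Literature.Computability.Cryptography.ShorProofs
import Mathlib.NumberTheory.NumberField.Units.Regulator
import Mathlib.NumberTheory.NumberField.ClassNumber
import HarnessLib

/-!
# Strategist sketch for crux `ArithStatLadder.IqThreeMemBQP` (stmt-QuantumAdvantage-2424)

Census signatures (STRATEGY-CENSUS.md), elaborated over tree constants. The live line
`scholz-mirror-siegel` has ONE open stub, S5 = the Literature named fact
`Hallgren2007_idealClassOrder_qsolvable` (order of one ideal class of a real quadratic field,
self-delimited, GRH-free). The statements below are the typed forms of the census attempts: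

* `ShortRegulatorClassOrder`  — TRANSFER of the imaginary primitive S8 (unique reduced
  representatives ⇒ discrete Kitaev/Shor) to the real side in the regime `R_F ≤ (log m)^C`
  (cycles are walkable, the least reduced ideal of a cycle is a canonical class representative);
* `LongRegulatorClassNumber`  — the ANALYTIC switch: for `R_F ≥ √m/(log m)^C` the class number
  `h_F = √D·L(1,χ_D)/(2R_F) ≤ polylog` is pinned EXACTLY by the integer part of `R_F` (tree fact
  `Hallgren2007_regulator_qsolvable_delim`, proved) and a classical log-uniform `L(1,χ)` meter
  (additive `ε` in `poly/ε²` samples; tail by the proved `RealChar.abs_sum_Ioc_reChar_le`);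
* `MiddleRegulatorClassOrder` — what neither switch reaches: S5 on `(log m)^C < R_F < √m/(log m)^C`;
  `middle_of_S5`, `short_of_S5` record that the regime statements are SPECIAL CASES of S5
  (`IsQSolvable.mono`), i.e. the decomposition-by-regime leaves the middle piece = the crux of S5;
* `RealSubgroupOrder` — STRENGTHEN S⁺1 (Hallgren's `ℤ^k × ℝ`, uniform in the number `k` of
  generators); `card_closure_singleton` is the `k = 1` read-back.
-/

set_option linter.dupNamespace false

noncomputable section

namespace Summit.QuantumAdvantage.QuantumAdvantage.Cruxes.IqThreeMemBQP.Strategist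

open _root_.Computability Literature.Computability.Complexity Literature.Computability.Cryptography
open scoped NumberField nonZeroDivisors

/-- TRANSFER T1 — the imaginary-side primitive (S8, `Hallgren2005.subgroupOrder_qsolvable`, proved)
moved to the real side in the SHORT-REGULATOR regime `R_F ≤ (log₂ m)^C`: the order of the class of
`(a, r + √m)`, self-delimited. Provable by walking whole cycles (≤ 2R/log 2 + 1 baby steps) to a
canonical representative and running the tree's Kitaev order-finding over unique encodings.
[this work: census signature] -/
def ShortRegulatorClassOrder : Prop :=
  ∀ C : ℕ, IsQSolvable fun x : List Bool =>
    {y | ∀ (F : Type) [Field F] [NumberField F] (m a r : ℕ) (α : 𝓞 F),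
      x = boolPair (encodeNat m) (boolPair (encodeNat a) (encodeNat r)) →
        Squarefree m → 2 ≤ m → Module.finrank ℚ F = 2 → (α : F) ^ 2 = (m : F) → 0 < a →
          (a : ℤ) ∣ (r : ℤ) ^ 2 - m →
            NumberField.Units.regulator F ≤ (Nat.log 2 m : ℝ) ^ C →
              ∀ hI : Ideal.span {(a : 𝓞 F), (r : 𝓞 F) + α} ∈ (Ideal (𝓞 F))⁰,
                ∃ t : List Bool, y = boolPair (encodeNat (orderOf (ClassGroup.mk0 ⟨_, hI⟩))) t}

/-- ANALYTIC switch A1 — LONG-REGULATOR regime `√m ≤ (log₂ m)^C · R_F`: the CLASS NUMBER of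
`F = ℚ(√m)` itself, self-delimited (then `3 ∣ h_F` is read off classically). Here
`h_F = √D L(1,χ_D)/(2 R_F) ≤ (log m)^{C+1}`, and `|ĥ − h_F| < 1/2` needs `L(1,χ_D)` only to additive
`R_F/√D ≥ (log m)^{−C}` (classical Monte-Carlo on the blocked Dirichlet series, Pólya–Vinogradov
tail) and `R_F` only to `±1` (the proved regulator fact). GRH-free; provable from tree pieces plus
Mathlib's analytic class number formula. [this work: census signature] -/
def LongRegulatorClassNumber : Prop :=
  ∀ C : ℕ, IsQSolvable fun x : List Bool =>
    {y | ∀ (F : Type) [Field F] [NumberField F],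
      Squarefree (decodeNat x) → 2 ≤ decodeNat x → Module.finrank ℚ F = 2 →
        (∃ α : F, α ^ 2 = (decodeNat x : F)) →
          Real.sqrt (decodeNat x) ≤ (Nat.log 2 (decodeNat x) : ℝ) ^ C * NumberField.Units.regulator F →
            ∃ t : List Bool, y = boolPair (encodeNat (NumberField.classNumber F)) t}

/-- The piece neither switch reaches: S5 restricted to the MIDDLE regime
`(log₂ m)^C < R_F < √m/(log₂ m)^C` (walking costs `~R_F`, the analytic pin costs `~m/R_F²`; the
product of the two costs is `≥ √m`). [this work: census signature] -/
def MiddleRegulatorClassOrder : Prop :=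
  ∀ C : ℕ, IsQSolvable fun x : List Bool =>
    {y | ∀ (F : Type) [Field F] [NumberField F] (m a r : ℕ) (α : 𝓞 F),
      x = boolPair (encodeNat m) (boolPair (encodeNat a) (encodeNat r)) →
        Squarefree m → 2 ≤ m → Module.finrank ℚ F = 2 → (α : F) ^ 2 = (m : F) → 0 < a →
          (a : ℤ) ∣ (r : ℤ) ^ 2 - m →
            (Nat.log 2 m : ℝ) ^ C < NumberField.Units.regulator F →
              (Nat.log 2 m : ℝ) ^ C * NumberField.Units.regulator F < Real.sqrt m →
                ∀ hI : Ideal.span {(a : 𝓞 F), (r : 𝓞 F) + α} ∈ (Ideal (𝓞 F))⁰,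
                  ∃ t : List Bool, y = boolPair (encodeNat (orderOf (ClassGroup.mk0 ⟨_, hI⟩))) t}

/-- S5 ⇒ its middle-regime restriction (`IsQSolvable.mono`): the regime split is a split into
special cases, and the middle case is all of S5's difficulty. [folklore] -/
theorem middle_of_S5 (h : Hallgren2007_idealClassOrder_qsolvable) : MiddleRegulatorClassOrder :=
  fun _ => h.mono fun _ _ hy F _ _ m a r α hx hsf h2 hrk hα ha hdvd _ _ hI =>
    hy F m a r α hx hsf h2 hrk hα ha hdvd hI

/-- S5 ⇒ its short-regulator restriction. [folklore] -/
theorem short_of_S5 (h : Hallgren2007_idealClassOrder_qsolvable) : ShortRegulatorClassOrder :=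
  fun _ => h.mono fun _ _ hy F _ _ m a r α hx hsf h2 hrk hα ha hdvd _ hI =>
    hy F m a r α hx hsf h2 hrk hα ha hdvd hI

/-- STRENGTHEN S⁺1 — Hallgren's `ℤ^k × ℝ` statement, uniform in the number of generators: the ORDER
of the subgroup of `Cl(F)` generated by the classes of a LIST of ideals `(aᵢ, rᵢ + √m)`,
self-delimited (GRH-free: no generation claimed). The `k = 1` instance is S5
(`card_closure_singleton`); no induction on `k` reaches `k = 1` from `k = 0` (the regulator), which
is where the continuous direction already sits. [this work: census signature] -/
def RealSubgroupOrder : Prop :=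
  IsQSolvable fun x : List Bool =>
    {y | ∀ (F : Type) [Field F] [NumberField F] (m : ℕ) (L : List (ℕ × ℕ)) (α : 𝓞 F),
      x = boolPair (encodeNat m) (encodeNat (Encodable.encode L)) →
        Squarefree m → 2 ≤ m → Module.finrank ℚ F = 2 → (α : F) ^ 2 = (m : F) →
          (∀ p ∈ L, 0 < p.1 ∧ (p.1 : ℤ) ∣ (p.2 : ℤ) ^ 2 - m) →
            ∀ hL : ∀ p ∈ L, Ideal.span {((p.1 : ℕ) : 𝓞 F), ((p.2 : ℕ) : 𝓞 F) + α} ∈ (Ideal (𝓞 F))⁰,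
              ∃ t : List Bool, y = boolPair (encodeNat (Nat.card
                (Subgroup.closure {g : ClassGroup (𝓞 F) | ∃ p, ∃ hp : p ∈ L,
                  g = ClassGroup.mk0 ⟨_, hL p hp⟩}))) t}

/-- Read-back at `k = 1`: the order of the subgroup generated by one class is the order of the class.
[folklore] -/
theorem card_closure_singleton {G : Type*} [Group G] (g : G) :
    Nat.card (Subgroup.closure ({g} : Set G)) = orderOf g := by
  rw [← Subgroup.zpowers_eq_closure, Nat.card_zpowers]

end Summit.QuantumAdvantage.QuantumAdvantage.Cruxes.IqThreeMemBQP.Strategist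

end
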